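import Summits.QuantumFields.YangMills.Theses.ConvexGribovBody
import Summits.QuantumFields.YangMills.Theorems.OneCertifiedCubeFiniteSizeCriterion
import HarnessLib

/-!
# `NonSimplyConnectedLatticeGap` — the transfer of line `Sketch` v9: AVERAGED weak mixing on cubes ⇒ crux
# (stub `stub_cruxOfMeanBoxInfluenceDecayNSC` (T″) of crux stmt-QuantumFields-16405, route `ConvexGribovBody`)

The v5 transfer T (`stub_cruxOfBoxInfluenceDecayNSC`, p127526) derived the crux from weak mixing on cubes over ALL
exterior data. The torus argument only ever uses the kernel mean `γ_{Λ_L}(A | Ũ)` at periodic lifts `Ũ = torusLift V`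
of torus configurations, integrated against the torus Wilson state `μ_S = wilsonMeasure r.ρ β` on `(2S+1)⁴`; so the
`L¹(μ_S)` oscillation of the kernel mean around the torus mean `μ_S(A)` suffices:

* `abs_cov_torus_le_meanBoxInfluence` — **duality form.** For a bounded measurable cylinder observable `A` of `ℤ⁴`,
  a finite link set `Λ` which with the support of `A` and its collar injects into the torus of side `M`, and ANY
  bounded measurable torus function `H`, `|H| ≤ D`, that does not see the links over the image of `Λ`:
  `|∫ A(Ũ) H dμ − (∫ A(Ũ) dμ)(∫ H dμ)| ≤ D ∫ |γ_Λ(A | Ũ) − ∫ A(Ũ) dμ| dμ(U)` (far-factor DLR on the torus,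
  `FiniteSizeCriterion.integral_torusLift_mul_eq_integral_ymSpecification_mul_of_measurable`, Georgii 2011 §8.2).
* `abs_latticeConnectedCorr_le_mul_meanBoxInfluence` — the `L¹` variant of
  `FiniteSizeCriterion.abs_latticeConnectedCorr_le_of_influence`: `|⟨A; τ_t B⟩_M| ≤ ‖B‖∞ ∫ |γ_Λ(A | Ũ) − μ(A)| dμ`
  when the torus image of `Λ` misses the support of `τ_t B` (translation invariance `⟨τ_t B⟩ = ⟨B⟩`).
* `clustering_of_meanBoxInfluenceDecay_at` — the core transfer at fixed `(G, ρ, β, m)`: averaged weak mixing on the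
  cubes `Λ_L = [−L,L]⁴ × univ` inside the tori `(2S+1)⁴`, `S ≥ L + 1`, at rate `m ≥ 0` ⇒
  `|⟨A; τ_t B⟩_{β,2S+1}| ≤ C(A,B) e^{−mt}` for all `S` and `t ≤ S` (geometry of T: `L = t − R_B − 1`).
* `stub_cruxOfMeanBoxInfluenceDecayNSC` — the registered stub T″ (crux from A″), and
  `uniformLatticeGap_of_meanBoxInfluenceDecay` — the rank-0 target `UniformLatticeGap` from the un-restricted A″.

References: H.-O. Georgii, *Gibbs Measures and Phase Transitions*, 2nd ed. (de Gruyter 2011), Prop. 2.5, Thm. 4.17,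
§8.2; F. Martinelli, LNM 1717 (1999), §2.3.
-/

set_option autoImplicit false

noncomputable section

open MeasureTheory Filter
open Literature.Probability.LatticeModels
open Literature.MathematicalPhysics.QuantumLattice
open Literature.MathematicalPhysics.QuantumFieldTheory (wilsonMeasure isProbabilityMeasure_wilsonMeasure
  latticeConnectedCorr measurable_torusLift isSpecification_ymSpecification_of_t2Space GaugeConfig LatticeRep
  YMSpecies IsCompactSimpleLieGroup)

namespace Summit.QuantumFields.YangMills.Theorems.NonSimplyConnectedLatticeGap

/-! ## The duality form: covariances with far factors through the mean influence of a box kernel -/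

section Duality

variable {N : ℕ} {G : Type} [Group G] [TopologicalSpace G] [IsTopologicalGroup G]
  [CompactSpace G] [MeasurableSpace G] [BorelSpace G] [SecondCountableTopology G] [T2Space G]
  (ρ : G →* Matrix (Fin N) (Fin N) ℂ)

/-- **Duality form of the averaged box influence.** Torus of side `M`, Wilson state `μ = wilsonMeasure ρ β`;
a bounded measurable cylinder observable `A` of `ℤ⁴` (support `SA`), a finite link set `Λ` such that
`Λ ∪ SA ∪ ∂Λ` injects into the torus, and a bounded measurable torus function `H`, `|H| ≤ D`, unchanged by
resampling the links over the image of `Λ`. Then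
`|∫ A(Ũ) H(U) dμ − (∫ A(Ũ) dμ)(∫ H dμ)| ≤ D ∫ |γ_Λ(A | Ũ) − ∫ A(Ũ) dμ| dμ(U)`:
the covariance of `A` with EVERYTHING outside the box is controlled by the mean influence of the box kernel.
Proof: far-factor DLR `∫ A(Ũ) H dμ = ∫ γ_Λ(A | Ũ) H dμ` and (far factor `1`) `∫ A(Ũ) dμ = ∫ γ_Λ(A | Ũ) dμ`
(Georgii 2011, Thm. 4.17, §8.2), so the covariance is `∫ (γ_Λ(A | Ũ) − μ(A)) H dμ`, and `|H| ≤ D`. -/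
theorem abs_cov_torus_le_meanBoxInfluence (hρ : Continuous ρ) (β : ℝ) {M : ℕ} [NeZero M]
    (Λ : Finset (ZdEdge 4)) {A : LGConfig 4 G → ℝ} (hAm : Measurable A) {CA : ℝ}
    (hAb : ∀ U, |A U| ≤ CA) {SA : Finset (ZdEdge 4)} (hAS : IsCylinder A SA)
    (hinj : Set.InjOn (Torus.proj M)
      ((Λ ∪ SA ∪ (plaquettesTouching Λ).biUnion plaquetteEdges).image Prod.fst : Set (Site 4)))
    {H : GaugeConfig 4 M G → ℝ} (hHm : Measurable H) {D : ℝ} (hHD : ∀ V, |H V| ≤ D)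
    (hH : ∀ W V, H ((Λ.image (torusEdge M)).piecewise W V) = H V) :
    |(∫ V, A (torusLift M V) * H V ∂(wilsonMeasure (d := 4) (L := M) ρ β)) -
        (∫ V, A (torusLift M V) ∂(wilsonMeasure (d := 4) (L := M) ρ β)) *
          ∫ V, H V ∂(wilsonMeasure (d := 4) (L := M) ρ β)| ≤
      D * ∫ V, |(∫ U, A U ∂(ymSpecification ρ β Λ (torusLift M V))) -
        ∫ W, A (torusLift M W) ∂(wilsonMeasure (d := 4) (L := M) ρ β)|
        ∂(wilsonMeasure (d := 4) (L := M) ρ β) := by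
  classical
  haveI := isProbabilityMeasure_wilsonMeasure (d := 4) (L := M) ρ hρ β
  have hγ := isSpecification_ymSpecification_of_t2Space (d := 4) ρ hρ β
  -- the kernel mean of `A`
  set g : LGConfig 4 G → ℝ := fun η => ∫ U, A U ∂(ymSpecification ρ β Λ η) with hgdef
  have hgm : Measurable g := DobrushinShlosman.measurable_windowAvg' hγ Λ hAm
  have hgb : ∀ η, |g η| ≤ CA := fun η => abs_integral_ymSpecification_le ρ hρ β Λ hAb η
  -- the far-factor DLR identity
  have h1 := FiniteSizeCriterion.integral_torusLift_mul_eq_integral_ymSpecification_mul_of_measurable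
    ρ hρ β Λ hAm hAb hAS hinj hHm hHD hH
  -- the covariance through the kernel mean
  set m : ℝ := ∫ V, A (torusLift M V) ∂(wilsonMeasure (d := 4) (L := M) ρ β) with hm
  have hgl : Measurable fun V : GaugeConfig 4 M G => g (torusLift M V) :=
    hgm.comp (measurable_torusLift M)
  have hgHi : Integrable (fun V => g (torusLift M V) * H V) (wilsonMeasure (d := 4) (L := M) ρ β) :=
    integrable_of_abs_le (hgl.mul hHm) (C := CA * D) fun V => by
      rw [abs_mul]
      exact mul_le_mul (hgb (torusLift M V)) (hHD V) (abs_nonneg _)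
        ((abs_nonneg _).trans (hgb (torusLift M V)))
  have hHi : Integrable H (wilsonMeasure (d := 4) (L := M) ρ β) := integrable_of_abs_le hHm hHD
  have hgi : Integrable (fun V => g (torusLift M V)) (wilsonMeasure (d := 4) (L := M) ρ β) :=
    integrable_of_abs_le hgl fun V => hgb _
  have hcov : (∫ V, A (torusLift M V) * H V ∂(wilsonMeasure (d := 4) (L := M) ρ β)) -
      m * ∫ V, H V ∂(wilsonMeasure (d := 4) (L := M) ρ β) =
      ∫ V, (g (torusLift M V) - m) * H V ∂(wilsonMeasure (d := 4) (L := M) ρ β) := by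
    rw [h1]
    simp_rw [sub_mul]
    rw [integral_sub hgHi (hHi.const_mul m), integral_const_mul]
  rw [hcov]
  calc |∫ V, (g (torusLift M V) - m) * H V ∂(wilsonMeasure (d := 4) (L := M) ρ β)|
      ≤ ∫ V, |(g (torusLift M V) - m) * H V| ∂(wilsonMeasure (d := 4) (L := M) ρ β) :=
        abs_integral_le_integral_abs
    _ ≤ ∫ V, D * |g (torusLift M V) - m| ∂(wilsonMeasure (d := 4) (L := M) ρ β) := by
        refine integral_mono_of_nonneg (ae_of_all _ fun V => abs_nonneg _)
          (((hgi.sub (integrable_const m)).abs).const_mul D) (ae_of_all _ fun V => ?_)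
        dsimp only
        rw [abs_mul, mul_comm]
        exact mul_le_mul_of_nonneg_right (hHD V) (abs_nonneg _)
    _ = D * ∫ V, |g (torusLift M V) - m| ∂(wilsonMeasure (d := 4) (L := M) ρ β) :=
        integral_const_mul _ _

/-- **Torus covariances are controlled by the MEAN influence of a box kernel** (the `L¹` variant of
`FiniteSizeCriterion.abs_latticeConnectedCorr_le_of_influence`). Torus of side `M`, Wilson state
`μ = wilsonMeasure ρ β`; bounded measurable cylinder observables `A` (support `SA`) and `B` (support `SB`) of `ℤ⁴`;
a finite link set `Λ` such that `Λ ∪ SA ∪ ∂Λ` injects into the torus and the torus image of `Λ` misses that of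
the support `SB + t e₀` of the time-`t` translate of `B`. Then
`|⟨A · τ_t B⟩_M − ⟨A⟩_M ⟨B⟩_M| ≤ ‖B‖∞ ∫ |γ_Λ(A | Ũ) − ⟨A⟩_M| dμ(U)`: the duality form with far factor
`H = τ_t B ∘ lift` and translation invariance `⟨τ_t B⟩ = ⟨B⟩` (Georgii 2011, §8.2, (8.29)–(8.31)). -/
theorem abs_latticeConnectedCorr_le_mul_meanBoxInfluence (hρ : Continuous ρ) (β : ℝ) {M : ℕ} [NeZero M]
    (Λ : Finset (ZdEdge 4)) {A B : LGConfig 4 G → ℝ} (hAm : Measurable A) (hBm : Measurable B)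
    {CA CB : ℝ} (hAb : ∀ U, |A U| ≤ CA) (hBb : ∀ U, |B U| ≤ CB)
    {SA SB : Finset (ZdEdge 4)} (hAS : IsCylinder A SA) (hBS : IsCylinder B SB) (t : ℕ)
    (hinj : Set.InjOn (Torus.proj M)
      ((Λ ∪ SA ∪ (plaquettesTouching Λ).biUnion plaquetteEdges).image Prod.fst : Set (Site 4)))
    (hfar : ∀ e ∈ SB.image (fun e : ZdEdge 4 => (e.1 - -Pi.single 0 (t : ℤ), e.2)), ∀ e' ∈ Λ,
      torusEdge M e ≠ torusEdge M e') :
    |latticeConnectedCorr ρ β M A B t| ≤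
      CB * ∫ V, |(∫ U, A U ∂(ymSpecification ρ β Λ (torusLift M V))) -
        ∫ W, A (torusLift M W) ∂(wilsonMeasure (d := 4) (L := M) ρ β)|
        ∂(wilsonMeasure (d := 4) (L := M) ρ β) := by
  classical
  set v : Fin 4 → ℤ := -Pi.single 0 (t : ℤ) with hv
  set H : GaugeConfig 4 M G → ℝ := fun V =>
    B (Literature.MathematicalPhysics.QuantumLattice.configShift v (torusLift M V)) with hHdef
  have hHm : Measurable H :=
    hBm.comp ((Literature.MathematicalPhysics.QuantumLattice.configShift v).measurable.comp
      (measurable_torusLift M))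
  have hHb : ∀ V, |H V| ≤ CB := fun V => hBb _
  have hHS : IsCylinder (B ∘ Literature.MathematicalPhysics.QuantumLattice.configShift v)
      (SB.image fun e : ZdEdge 4 => (e.1 - v, e.2)) :=
    Literature.MathematicalPhysics.QuantumFieldTheory.IsCylinder.comp_configShift hBS v
  have hHpw : ∀ W V, H (((Λ.image (torusEdge M)).piecewise W V)) = H V := fun W V =>
    apply_torusLift_piecewise_eq hHS hfar W V
  have h3 := integral_comp_configShift_torusLift (S := M) ρ β B v
  have h := abs_cov_torus_le_meanBoxInfluence ρ hρ β Λ hAm hAb hAS hinj hHm hHb hHpw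
  unfold Literature.MathematicalPhysics.QuantumFieldTheory.latticeConnectedCorr
  rw [← h3]
  exact h

end Duality

/-! ## The core transfer at fixed `(G, ρ, β, m)` -/

section Core

variable {N : ℕ} {G : Type} [Group G] [TopologicalSpace G] [IsTopologicalGroup G]
  [CompactSpace G] [MeasurableSpace G] [BorelSpace G] [SecondCountableTopology G] [T2Space G]
  (ρ : G →* Matrix (Fin N) (Fin N) ℂ)

/-- **Averaged weak mixing on cubes ⇒ volume-uniform torus clustering, rate preserved** (every compact metrisable
`G`, every continuous representation `ρ`, every `β`, every rate `m ≥ 0`). If for every gauge-invariant local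
observable `A` there is `C_A` with `∫ |γ_{Λ_L}(A | Ũ) − μ_S(A)| dμ_S(U) ≤ C_A e^{−mL}` for all cubes
`Λ_L = [−L,L]⁴ × univ` containing the support of `A` and all tori `(2S+1)⁴` with `S ≥ L + 1`
(`μ_S = wilsonMeasure ρ β`), then for all `A, B` there is `C` with `|⟨A; τ_t B⟩_{β,2S+1}| ≤ C e^{−mt}` for all `S`
and all `t ≤ S`. Proof: for `t ≥ R_A + R_B + 2` the cube of radius `L = t − R_B − 1` contains the support of `A`,
injects into the torus with its collar (`L + 1 ≤ S`) and misses the support of `τ_t B`, so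
`abs_latticeConnectedCorr_le_mul_meanBoxInfluence` bounds the correlation by
`‖B‖∞ C_A e^{−mL} = ‖B‖∞ C_A e^{m(R_B+1)} e^{−mt}`; for smaller `t` use `|corr| ≤ 2‖A‖∞‖B‖∞`. -/
theorem clustering_of_meanBoxInfluenceDecay_at (hρ : Continuous ρ) (β : ℝ) {m : ℝ} (hm : 0 ≤ m)
    (hMM : ∀ A : LocalGaugeObservable 4 G, ∃ C : ℝ, ∀ (L S : ℕ),
      A.supp ⊆ ((Fintype.piFinset fun _ : Fin 4 => Finset.Icc (-((L : ℕ) : ℤ)) ((L : ℕ) : ℤ)) ×ˢ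
        (Finset.univ : Finset (Fin 4))) → L + 1 ≤ S →
      ∫ V, |(∫ U, A.F U ∂(ymSpecification ρ β ((Fintype.piFinset fun _ : Fin 4 =>
          Finset.Icc (-((L : ℕ) : ℤ)) ((L : ℕ) : ℤ)) ×ˢ (Finset.univ : Finset (Fin 4)))
          (torusLift (2 * S + 1) V))) -
        ∫ W, A.F (torusLift (2 * S + 1) W) ∂(wilsonMeasure (d := 4) (L := 2 * S + 1) ρ β)|
        ∂(wilsonMeasure (d := 4) (L := 2 * S + 1) ρ β) ≤ C * Real.exp (-(m * L)))
    (A B : LocalGaugeObservable 4 G) :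
    ∃ C : ℝ, ∀ S t : ℕ, t ≤ S →
      |latticeConnectedCorr ρ β (2 * S + 1) A.F B.F t| ≤ C * Real.exp (-(m * t)) := by
  -- adapted from `clustering_of_boxInfluenceDecay_at` (T, p127526): step (iii) is the `L¹` bound
  obtain ⟨CA, hCA⟩ := A.bounded
  obtain ⟨CB, hCB⟩ := B.bounded
  have hCA0 : 0 ≤ CA := (abs_nonneg _).trans (hCA fun _ => 1)
  have hCB0 : 0 ≤ CB := (abs_nonneg _).trans (hCB fun _ => 1)
  -- the radii of the supports
  set RA : ℕ := A.supp.sup fun e => Finset.univ.sup fun i => (e.1 i).natAbs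
  set RB : ℕ := B.supp.sup fun e => Finset.univ.sup fun i => (e.1 i).natAbs
  have hRA : ∀ e ∈ A.supp, ∀ i, |e.1 i| ≤ RA := fun e he i => by
    rw [Int.abs_eq_natAbs, Int.ofNat_le]
    exact (Finset.le_sup (f := fun i => (e.1 i).natAbs) (Finset.mem_univ i)).trans
      (Finset.le_sup (f := fun e : ZdEdge 4 => Finset.univ.sup fun i => (e.1 i).natAbs) he)
  have hRB : ∀ e ∈ B.supp, ∀ i, |e.1 i| ≤ RB := fun e he i => by
    rw [Int.abs_eq_natAbs, Int.ofNat_le]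
    exact (Finset.le_sup (f := fun i => (e.1 i).natAbs) (Finset.mem_univ i)).trans
      (Finset.le_sup (f := fun e : ZdEdge 4 => Finset.univ.sup fun i => (e.1 i).natAbs) he)
  clear_value RA RB
  -- the mean cube-influence constant of `A`, made non-negative
  obtain ⟨KA₀, hKA⟩ := hMM A
  set KA : ℝ := max KA₀ 0 with hKAdef
  have hKA0 : 0 ≤ KA := le_max_right _ _
  have hKA1 : KA₀ ≤ KA := le_max_left _ _
  clear_value KA
  -- the constant
  refine ⟨2 * CA * CB * Real.exp (m * (RA + RB + 2)) + CB * KA * Real.exp (m * (RB + 1)), ?_⟩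
  intro S t ht
  haveI := isProbabilityMeasure_wilsonMeasure (d := 4) (L := 2 * S + 1) ρ hρ β
  -- the trivial bound
  have htriv : |latticeConnectedCorr ρ β (2 * S + 1) A.F B.F t| ≤ 2 * CA * CB := by
    unfold Literature.MathematicalPhysics.QuantumFieldTheory.latticeConnectedCorr
    have h1 : |∫ U, A.F (torusLift (2 * S + 1) U) *
        B.F (Literature.MathematicalPhysics.QuantumLattice.configShift (-Pi.single 0 (t : ℤ))
          (torusLift (2 * S + 1) U)) ∂(wilsonMeasure (d := 4) (L := 2 * S + 1) ρ β)| ≤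
        CA * CB :=
      abs_integral_le_of_abs_le fun U => by
        rw [abs_mul]
        exact mul_le_mul (hCA _) (hCB _) (abs_nonneg _) hCA0
    have h2 : |∫ U, A.F (torusLift (2 * S + 1) U) ∂(wilsonMeasure (d := 4) (L := 2 * S + 1) ρ β)|
        ≤ CA := abs_integral_le_of_abs_le fun U => hCA _
    have h3 : |∫ U, B.F (torusLift (2 * S + 1) U) ∂(wilsonMeasure (d := 4) (L := 2 * S + 1) ρ β)|
        ≤ CB := abs_integral_le_of_abs_le fun U => hCB _
    calc _ ≤ |∫ U, A.F (torusLift (2 * S + 1) U) *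
          B.F (Literature.MathematicalPhysics.QuantumLattice.configShift (-Pi.single 0 (t : ℤ))
            (torusLift (2 * S + 1) U)) ∂(wilsonMeasure (d := 4) (L := 2 * S + 1) ρ β)| +
          |(∫ U, A.F (torusLift (2 * S + 1) U) ∂(wilsonMeasure (d := 4) (L := 2 * S + 1) ρ β)) *
            ∫ U, B.F (torusLift (2 * S + 1) U) ∂(wilsonMeasure (d := 4) (L := 2 * S + 1) ρ β)| :=
          abs_sub _ _
      _ ≤ CA * CB + CA * CB := by
          rw [abs_mul]
          exact add_le_add h1 (mul_le_mul h2 h3 (abs_nonneg _) hCA0)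
      _ = 2 * CA * CB := by ring
  by_cases hcase : RA + RB + 2 ≤ t
  swap
  · -- the supports are close in time: the trivial bound suffices
    have htle : (t : ℝ) ≤ RA + RB + 2 := by exact_mod_cast (not_le.1 hcase).le
    have hexp : 1 ≤ Real.exp (m * (RA + RB + 2)) * Real.exp (-(m * t)) := by
      rw [← Real.exp_add]
      refine Real.one_le_exp ?_
      have h := mul_le_mul_of_nonneg_left htle hm
      linarith only [h]
    calc |latticeConnectedCorr ρ β (2 * S + 1) A.F B.F t| ≤ 2 * CA * CB := htriv
      _ = 2 * CA * CB * 1 + 0 := by ring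
      _ ≤ 2 * CA * CB * (Real.exp (m * (RA + RB + 2)) * Real.exp (-(m * t))) +
            CB * KA * Real.exp (m * (RB + 1)) * Real.exp (-(m * t)) := by
          gcongr
          positivity
      _ = (2 * CA * CB * Real.exp (m * (RA + RB + 2)) + CB * KA * Real.exp (m * (RB + 1))) *
            Real.exp (-(m * t)) := by ring
  · -- the main case: the cube of radius `L = t - R_B - 1` with its collar fits strictly between
    -- the support of `A` and the time-`t` translate of the support of `B`
    obtain ⟨L, hL⟩ : ∃ L : ℕ, L = t - RB - 1 := ⟨_, rfl⟩
    have hLt : L + RB + 1 = t := by omega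
    have hRAL : RA + 1 ≤ L := by omega
    have hLS : L + 1 ≤ S := by omega
    -- integer forms of the separation facts
    have hI1 : (L : ℤ) + RB + 1 = t := by exact_mod_cast hLt
    have hI2 : (t : ℤ) ≤ S := by exact_mod_cast ht
    have hRAL' : (RA : ℤ) + 1 ≤ L := by exact_mod_cast hRAL
    have hLS' : (L : ℤ) + 1 ≤ S := by exact_mod_cast hLS
    -- the cube `Λ` of radius `L`
    obtain ⟨Λ, hΛ⟩ : ∃ Λ : Finset (ZdEdge 4), Λ = (Fintype.piFinset fun _ : Fin 4 =>
      Finset.Icc (-((L : ℕ) : ℤ)) ((L : ℕ) : ℤ)) ×ˢ (Finset.univ : Finset (Fin 4)) := ⟨_, rfl⟩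
    have hmemΛ : ∀ e ∈ Λ, ∀ i, -(L : ℤ) ≤ e.1 i ∧ e.1 i ≤ L := by
      intro e he i
      rw [hΛ, Finset.mem_product, Fintype.mem_piFinset] at he
      exact Finset.mem_Icc.1 (he.1 i)
    -- (o) the cube contains the support of `A`
    have hsuppΛ : A.supp ⊆ Λ := by
      intro e he
      rw [hΛ, Finset.mem_product, Fintype.mem_piFinset]
      refine ⟨fun i => Finset.mem_Icc.2 ?_, Finset.mem_univ _⟩
      have h := abs_le.1 (hRA e he i)
      constructor <;> linarith only [h.1, h.2, hRAL']
    -- (i) `Λ`, the support of `A` and the collar of `Λ` inject into the torus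
    have hwide : ∀ e ∈ Λ ∪ A.supp ∪ (plaquettesTouching Λ).biUnion plaquetteEdges, ∀ i,
        -(L : ℤ) - 1 ≤ e.1 i ∧ e.1 i ≤ L + 1 := by
      intro e he i
      simp only [Finset.mem_union] at he
      rcases he with (he | he) | he
      · have h := hmemΛ e he i
        constructor <;> linarith only [h.1, h.2]
      · have h := abs_le.1 (hRA e he i)
        constructor <;> linarith only [h.1, h.2, hRAL']
      · obtain ⟨e', he', hn'⟩ := exists_near_of_mem_collar he
        have h := hmemΛ e' he' i
        have h' := hn' i
        constructor <;> linarith only [h.1, h.2, h'.1, h'.2]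
    have hinj : Set.InjOn (Torus.proj (2 * S + 1))
        ((Λ ∪ A.supp ∪ (plaquettesTouching Λ).biUnion plaquetteEdges).image Prod.fst :
          Set (Site 4)) := by
      refine (FiniteSizeCriterion.injOn_torusProj_of_width (M := 2 * S + 1) (lo := -(L : ℤ) - 1)
        (hi := (L : ℤ) + 1) (by push_cast; linarith only [hLS'])).mono fun x hx => ?_
      obtain ⟨e, he, rfl⟩ := Finset.mem_image.1 (Finset.mem_coe.1 hx)
      exact hwide e he
    -- (ii) the torus image of `Λ` misses the translate of the support of `B`
    have hfar : ∀ e ∈ B.supp.image (fun e : ZdEdge 4 => (e.1 - -Pi.single 0 (t : ℤ), e.2)),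
        ∀ e' ∈ Λ, torusEdge (2 * S + 1) e ≠ torusEdge (2 * S + 1) e' := by
      intro e he e' he' heq
      obtain ⟨e₀, he₀, rfl⟩ := Finset.mem_image.1 he
      have h0 := abs_le.1 (hRB e₀ he₀ 0)
      have h1 := hmemΛ e' he' 0
      have hproj : ((e₀.1 0 + t : ℤ) : ZMod (2 * S + 1)) = ((e'.1 0 : ℤ) : ZMod (2 * S + 1)) := by
        have h := congr_fun (congr_arg Prod.fst heq) 0
        simp only [torusEdge] at h
        simpa [Torus.proj_apply] using h
      rw [ZMod.intCast_eq_intCast_iff_dvd_sub] at hproj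
      -- `0 < (e₀.1 0 + t) - e'.1 0 < 2S+1`, contradicting divisibility
      have hpos : 0 < e₀.1 0 + t - e'.1 0 := by linarith only [h0.1, h1.2, hI1]
      have hlt' : e₀.1 0 + t - e'.1 0 < ((2 * S + 1 : ℕ) : ℤ) := by
        push_cast; linarith only [h0.2, h1.1, hI1, hI2]
      have hdvd : (((2 * S + 1 : ℕ) : ℤ)) ∣ e₀.1 0 + t - e'.1 0 := by
        have h := hproj
        rwa [← neg_sub, dvd_neg] at h
      exact absurd (Int.le_of_dvd hpos hdvd) (not_le.2 hlt')
    -- (iii) the MEAN cube-influence bound on the torus and the covariance bound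
    have hmean := hKA L S (by rw [← hΛ]; exact hsuppΛ) hLS
    rw [← hΛ] at hmean
    have hcov := abs_latticeConnectedCorr_le_mul_meanBoxInfluence ρ hρ β (M := 2 * S + 1) Λ
      A.measurable B.measurable hCA hCB A.isCylinder B.isCylinder t hinj hfar
    have hfin : |latticeConnectedCorr ρ β (2 * S + 1) A.F B.F t| ≤
        CB * (KA * Real.exp (-(m * L))) :=
      hcov.trans (mul_le_mul_of_nonneg_left
        (hmean.trans (mul_le_mul_of_nonneg_right hKA1 (Real.exp_pos _).le)) hCB0)
    -- (iv) compare with `C e^{−m t}` using `L = t − R_B − 1`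
    have hLr : (L : ℝ) + RB + 1 = t := by exact_mod_cast hLt
    have hexp : Real.exp (-(m * L)) = Real.exp (m * (RB + 1)) * Real.exp (-(m * t)) := by
      rw [← Real.exp_add, ← hLr]
      ring_nf
    calc |latticeConnectedCorr ρ β (2 * S + 1) A.F B.F t| ≤ CB * (KA * Real.exp (-(m * L))) := hfin
      _ = 0 + CB * KA * Real.exp (m * (RB + 1)) * Real.exp (-(m * t)) := by rw [hexp]; ring
      _ ≤ 2 * CA * CB * Real.exp (m * (RA + RB + 2)) * Real.exp (-(m * t)) +
            CB * KA * Real.exp (m * (RB + 1)) * Real.exp (-(m * t)) := by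
          gcongr
          positivity
      _ = (2 * CA * CB * Real.exp (m * (RA + RB + 2)) + CB * KA * Real.exp (m * (RB + 1))) *
            Real.exp (-(m * t)) := by ring

end Core

/-! ## The registered transfer T″ and the target-level funnel -/

/-- **STUB T″ — averaged weak mixing on cubes at large `β` for `π₁(G) ≠ 0` ⇒ `NonSimplyConnectedLatticeGap`**
(registered stub `stub_cruxOfMeanBoxInfluenceDecayNSC` of the skeleton `Cruxes/NonSimplyConnectedLatticeGap/Lines/Sketch.lean`
v9 of item stmt-QuantumFields-16405). Far-factor DLR on the torus in `L¹` form: `⟨A; τ_t B⟩_S =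
∫ (γ_{Λ_L}A(Ũ) − μ_S(A)) · τ_tB(Ũ) dμ_S` with `L = t − R_B − 1`, so `|⟨A; τ_t B⟩_S| ≤ ‖B‖∞ ∫|γ_{Λ_L}A(Ũ) − μ_S(A)| dμ_S
≤ ‖B‖∞ C_A e^{−mL}`; small `t` by the trivial bound (`clustering_of_meanBoxInfluenceDecay_at`, `S₁ = 0`). -/
theorem stub_cruxOfMeanBoxInfluenceDecayNSC : (∀ (G : Type) [Group G] [TopologicalSpace G] [IsTopologicalGroup G] [CompactSpace G] [MeasurableSpace G] [BorelSpace G], Literature.MathematicalPhysics.QuantumFieldTheory.IsCompactSimpleLieGroup G → ¬ SimplyConnectedSpace G → ∀ r : Literature.MathematicalPhysics.QuantumFieldTheory.LatticeRep G, ∃ β₂ : ℝ, ∀ β : ℝ, β₂ ≤ β → ∃ m : ℝ, 0 < m ∧ ∀ A : Literature.MathematicalPhysics.QuantumFieldTheory.YMSpecies G, ∃ C : ℝ, ∀ (L S : ℕ), A.supp ⊆ ((Fintype.piFinset fun _ : Fin 4 => Finset.Icc (-((L : ℕ) : ℤ)) ((L : ℕ) : ℤ)) ×ˢ (Finset.univ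 : Finset (Fin 4))) → L + 1 ≤ S → ∫ V, |(∫ U, A.F U ∂(Literature.MathematicalPhysics.QuantumLattice.ymSpecification r.ρ β ((Fintype.piFinset fun _ : Fin 4 => Finset.Icc (-((L : ℕ) : ℤ)) ((L : ℕ) : ℤ)) ×ˢ (Finset.univ : Finset (Fin 4))) (Literature.MathematicalPhysics.QuantumLattice.torusLift (2 * S + 1) V))) - ∫ W, A.F (Literature.MathematicalPhysics.QuantumLattice.torusLift (2 * S + 1) W) ∂(Literature.MathematicalPhysics.QuantumFieldTheory.wilsonMeasure (d := 4) (L := 2 * S + 1) r.ρ β)| ∂(Literature.MathematicalPhysics.QuantumFieldTheory.wilsonMeasure (d := 4) (L := 2 * S + 1) r.ρ β) ≤ C * Real.exp (-(m * L))) → Summit.QuantumFields.YangMills.Theses.ConvexGribovBody.NonSimplyConnectedLatticeGap := by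
  intro h G _ _ _ _ _ _ hG hnsc r
  obtain ⟨β₂, hβ₂⟩ := h G hG hnsc r
  refine ⟨β₂, fun β hβ => ?_⟩
  obtain ⟨m, hm, hAll⟩ := hβ₂ β hβ
  refine ⟨m, hm, 0, fun A B => ?_⟩
  haveI : T2Space G := (r.continuous.isClosedEmbedding r.injective).isEmbedding.t2Space
  haveI : SecondCountableTopology G :=
    (r.continuous.isClosedEmbedding r.injective).isEmbedding.secondCountableTopology
  obtain ⟨C, hC⟩ := clustering_of_meanBoxInfluenceDecay_at r.ρ r.continuous β hm.le hAll A B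
  exact ⟨C, fun S n _ hn => hC S n hn⟩

/-- **Averaged weak mixing on cubes at large `β` ⇒ the rank-0 target `UniformLatticeGap`** (all compact simple `G`,
all faithful unitary `r`): the hypothesis is the un-restricted form (no `¬ SimplyConnectedSpace G`) of the open leaf
A″ `stub_meanBoxInfluenceDecayNSC` of line `Sketch` v9; conclusion `ConvexGribovBody.UniformLatticeGap` (whose
`π₁ ≠ 0` half is the crux `NonSimplyConnectedLatticeGap`). Core transfer + `S₁ = 0`. -/
theorem uniformLatticeGap_of_meanBoxInfluenceDecay : (∀ (G : Type) [Group G] [TopologicalSpace G] [IsTopologicalGroup G] [CompactSpace G] [MeasurableSpace G] [BorelSpace G], Literature.MathematicalPhysics.QuantumFieldTheory.IsCompactSimpleLieGroup G → ∀ r : Literature.MathematicalPhysics.QuantumFieldTheory.LatticeRep G, ∃ β₂ : ℝ, ∀ β : ℝ, β₂ ≤ β → ∃ m : ℝ, 0 < m ∧ ∀ A : Literature.MathematicalPhysics.QuantumFieldTheory.YMSpecies G, ∃ C : ℝ, ∀ (L S : ℕ), A.supp ⊆ ((Fintype.piFinset fun _ : Fin 4 => Finset.Icc (-((L : ℕ)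 : ℤ)) ((L : ℕ) : ℤ)) ×ˢ (Finset.univ : Finset (Fin 4))) → L + 1 ≤ S → ∫ V, |(∫ U, A.F U ∂(Literature.MathematicalPhysics.QuantumLattice.ymSpecification r.ρ β ((Fintype.piFinset fun _ : Fin 4 => Finset.Icc (-((L : ℕ) : ℤ)) ((L : ℕ) : ℤ)) ×ˢ (Finset.univ : Finset (Fin 4))) (Literature.MathematicalPhysics.QuantumLattice.torusLift (2 * S + 1) V))) - ∫ W, A.F (Literature.MathematicalPhysics.QuantumLattice.torusLift (2 * S + 1) W) ∂(Literature.MathematicalPhysics.QuantumFieldTheory.wilsonMeasure (d := 4) (L := 2 * S + 1) r.ρ β)| ∂(Literature.MathematicalPhysics.QuantumFieldTheory.wilsonMeasure (d := 4) (L := 2 * S + 1) r.ρ β) ≤ C * Real.exp (-(m * L))) → Summit.QuantumFields.YangMills.Theses.ConvexGribovBody.UniformLatticeGap := by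
  intro h G _ _ _ _ _ _ hG r
  obtain ⟨β₂, hβ₂⟩ := h G hG r
  refine ⟨β₂, fun β hβ => ?_⟩
  obtain ⟨m, hm, hAll⟩ := hβ₂ β hβ
  refine ⟨m, hm, 0, fun A B => ?_⟩
  haveI : T2Space G := (r.continuous.isClosedEmbedding r.injective).isEmbedding.t2Space
  haveI : SecondCountableTopology G :=
    (r.continuous.isClosedEmbedding r.injective).isEmbedding.secondCountableTopology
  obtain ⟨C, hC⟩ := clustering_of_meanBoxInfluenceDecay_at r.ρ r.continuous β hm.le hAll A B
  exact ⟨C, fun S n _ hn => hC S n hn⟩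

end Summit.QuantumFields.YangMills.Theorems.NonSimplyConnectedLatticeGap

end
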